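import Summits.QuantumFields.BalabanUV.Beta.ReflectionLocusSymShift
import Summits.QuantumFields.BalabanUV.Beta.LambdaPieceReflection
import Summits.QuantumFields.BalabanUV.Beta.DshAn1End
import Summits.QuantumFields.BalabanUV.Beta.SymTablesAn1FirstOrder

/-!
# `BalabanUV.Beta.ReflectionLocusSymPure` — binder row D1, (N7)-prep: **THE (Sr-conj) LAW OF THE (0.4) LITERAL's UNFOLDED (PURE) FIRST-ORDER TABLES
# `SpureSymOf tabs` AND OF ITS MULTIPLIER TABLES `M1Of H cΛ` AT EVERY LEVEL** — the `hS`∕`hM` inputs of `SecondOrderTransport.W2SymOfK_bref_sharp` for the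
# literal's W-recursion (`WsymOf = WrecOf Gsym SpureSymOf M …`), from g28's FOLDED law `ReflectionLocusSymShift.hSrC_SsymOf_all` by subtracting the PURE-SIGN
# law of the Λ-sector (slot twins of an2-g17's `SpineRecursivePureLaws.pureZero_bref`∕`pureSucc_bref`∕`M1At_bref`); instances at an1's typed shift `Dsh Lc`
# (every shift letter a theorem, as in `DshAn1End` §8) and at an1's first-order table record `symTablesAn1` ((V-ff0) discharged)
# (β sub-cell, BINDER-OWNERS row D1 OWNER `b2b-balaban-beta-an2`, gen 30; memo `gen30/N7-SCOPE.v1.md` §3 rows «`SpureRecAt_bref`», «`M1At_bref`»)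

HONEST FRAMING (cell charter, verbatim): «discharging BetaPertH makes Bałaban's UV stability UNCONDITIONAL — a real constructive-QFT result; it is
NOT the continuum limit and NOT the Clay problem.»  HONEST DEPENDENCY: continuum YM on T⁴ ⇐ BetaPertH ∧ nine spine estimates (0/9 proved);
BetaPertH ⇐ (D1) ∧ (D4) ∧ CAP+tail; G-an2-4 gates asym, D1 and NE2/3/4.
NOT IN PRINT; OUR BOOKKEEPING.  [folklore] kernel algebra over tree objects BY NAME (`ReflectionLocusSymShift.hSrC_SrecOf_Gsym_all_bcj`∕`hSrC_SsymOf_all`,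
`LambdaPieceReflection.SLam_reflect`∕`lamCoeffOf_KInv_reflect`, `StepReflectionRecSlot.smul_SLam_step_reflect_slot`, `RecursiveStencilSlot`'s Λ-splits
`SrecOf_eq_SpureRecOf_add_lam_zero∕_succ`, an1's shift letters `DshAn1*`, `SymShiftGaugeBlind`).  The table reflection letters (V-r)(H-r) (and (V-ff0) where not
discharged) stay DISPLAYED HYPOTHESES — for an1's sym tables they are an1's TABLES-SYM step S2c.  No statement of Bałaban's papers, no `[cite:]`, no `def`, no
`def … : Prop`; instantiates NO binder of the β-function wall; the root of record (`RowD1JointEndSymWardTablesAn1`, p273819) is NOT touched — this file prepares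
the port (N7) of the second-order hR chain (`SpineRecursiveT2Step`∕`…WEnd` need exactly these pure laws).  NOT D1, NOT `BetaPertH`, NOT continuum, NOT Clay.

* §1 slot-generic (any `d`): `SLam_lamCoeffOf_reflect_slot` (the level-0 Λ-sector with a GENERIC Hessian table reflects by a pure sign, given (H-r));
  **`M1Of_bref`** (the multiplier tables over a generic `H` reflect by a pure sign — ♯-table = table); **`SpureRecOf_bref_of_SrecOf_bref`** (the pure tables
  inherit the folded family's (Sr-conj) law WITH THE SAME CONTACT, every level).
* §2 the literal (`d + 1 = 4`, pins of record): **`SpureSymOf_bref_all`** — hypotheses EXACTLY those of `hSrC_SsymOf_all` (shift letters + (V-r)(V-ff0)(H-r)).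
* §3 at an1's typed shift `Dsh Lc`: **`SpureSymOf_bref_all_an1Shift`** — hypotheses (V-r)(V-ff0)(H-r) only.
* §4 at an1's table record `symTablesAn1 3 Lc …`: **`SpureSymOf_bref_all_an1Tables`**, **`M1Of_symHessFFAt_bref`** — hypotheses (V-r)(H-r) about an1's concrete
  `symVhSAt (ctr 4 Lc) 3 Lc`∕`symHessFFAt (ctr 4 Lc) Lc` only (the binders `hVfm`∕`hVmf`∕`hVmm`∕`hHr` of the root p273819, verbatim).
Provenance: β sub-cell, unit beta-an2 gen 30, 2026-08-21 (v1); over the files named above BY NAME; no existing file touched.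
-/

noncomputable section

open Finset
open scoped BigOperators
open Literature.Probability.LatticeModels (Torus.proj)
open Literature.MathematicalPhysics.QuantumFieldTheory
open Literature.MathematicalPhysics.QuantumFieldTheory.Balaban1983to89
open Literature.MathematicalPhysics.QuantumFieldTheory.Balaban1983to89.Beta
open ExpKernelCalculus (MKer comp VertexFamily)
open PolarizationSign (reflSign)
open KernelReflection (refK refK_apply)
open ResolventReflection (bref Φ)
open AffineAveraging (unitVec)
open AveragingContours (blk)
open AveragingContoursRooted (ctr ctrOff ctrOff_mem_box)
open LatticeForm (quo)
open OneStepResolventKernel (Fib KInv LocStencil)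
open OneStepKernelFamily (KInvStep)
open InterLevelTransport (SLam)
open BalabanStepJets (lamCoeffOf)
open BalabanStepJetsSucc (lamCoeffK E2 wVH wΛ)
open BalabanCompositeJets (LocStencil₂)
open SecondOrderResponse (LocStencilFM)
open Summit.QuantumFields.BalabanUV.Beta.TameKernelCalculus
open Summit.QuantumFields.BalabanUV.Beta.ChartConjugation (conjV)
open Summit.QuantumFields.BalabanUV.Beta.E3LevelOneReflection (refK_sub refK_smul)
open Summit.QuantumFields.BalabanUV.Beta.AxialDressingRooted (one_le_of_neZero)
open Summit.QuantumFields.BalabanUV.Beta.BorderedHessian (bhK stepScale diagK)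
open Summit.QuantumFields.BalabanUV.Beta.SymSliceProjectorKernel (symEc)
open Summit.QuantumFields.BalabanUV.Beta.SpineRooted (SpureRecOf SrecOf_eq_SpureRecOf_add_lam_zero SrecOf_eq_SpureRecOf_add_lam_succ M1Of M1Of_apply
  SLam_reflect lamCoeffOf_KInv_reflect)
open Summit.QuantumFields.BalabanUV.Beta.WardLocusRecursive (SrecOf)
open Summit.QuantumFields.BalabanUV.Beta.StepReflectionRecSlot (smul_SLam_step_reflect_slot)
open Summit.QuantumFields.BalabanUV.Beta.SymmetrisedStepJets (SymTables Gsym SsymOf SsymOf_eq SpureSymOf)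
open Summit.QuantumFields.BalabanUV.Beta.SymShiftedSpread (bhKStepSh)
open Summit.QuantumFields.BalabanUV.Beta.E3ContactGenerator (ctGenM)
open Summit.QuantumFields.BalabanUV.Beta.ReflectionLocusSymShift (hSrC_SsymOf_all)
open Summit.QuantumFields.BalabanUV.Beta.DshAn1 (Dsh lam04 Dsh_inl_inl Dsh_inr_inr Dsh_inr_inl_eq_neg Dsh_inl_inr_eq_sub lam04_eq_zero_of_ne_blk spr_Dsh
  comp_comp_symEc_Dsh_symEc)
open Summit.QuantumFields.BalabanUV.Beta.SymShiftGaugeBlind (comp_Gsym_Dsh_inr_inl_of_grad comp_Dsh_Gsym_inl_inr_of_grad)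
open Summit.QuantumFields.BalabanUV.Beta.SymAveragingHessianCounts (symVhSAt symHessFFAt symVhSAt_hV0_ctr)
open Summit.QuantumFields.BalabanUV.Beta.SymTablesAn1FirstOrder (symTablesAn1)

namespace Summit.QuantumFields.BalabanUV.Beta.ReflectionLocusSymPure

variable {d : ℕ} {Lc : ℕ} [NeZero Lc]

/-! ## §1 Slot-generic: Λ-sector and multiplier tables reflect by pure signs; the pure tables inherit the folded law -/

section Slot

variable {V H : Fin (d + 1) → (Fin (d + 1) → ℤ) → MKer (d + 1) (Fib d)} {G : ℕ → MKer (d + 1) (Fib d)}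

/-- [folklore] **THE LEVEL-0 Λ-SECTOR WITH A GENERIC HESSIAN TABLE REFLECTS BY A PURE SIGN** given (H-r) (`SLam_reflect` with an5's
`lamCoeffOf_KInv_reflect`; slot twin of `LambdaPieceReflection.SLam_lamCoeffOf_hessFFAt_reflect`). -/
theorem SLam_lamCoeffOf_reflect_slot
    (hH : ∀ (α μ : Fin (d + 1)) (y : Fin (d + 1) → ℤ), H μ (bref α μ y) = reflSign α μ • refK (Φ (d := d) Lc α) (H μ y))
    (α κ' : Fin (d + 1)) (u : Fin (d + 1) → ℤ) :
    SLam Lc (lamCoeffOf (KInv (N := Lc) (d := d)) Lc) H κ' (bref α κ' u) =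
      reflSign α κ' • refK (Φ Lc α) (SLam Lc (lamCoeffOf (KInv (N := Lc) (d := d)) Lc) H κ' u) :=
  SLam_reflect (fun μ y κ'' u' => lamCoeffOf_KInv_reflect α μ y κ'' u') (fun μ y => hH α μ y) κ' u

omit [NeZero Lc] in
/-- [folklore] **THE MULTIPLIER TABLES OVER A GENERIC HESSIAN TABLE REFLECT BY A PURE SIGN** (`M1Of H cΛ j μ w = (cΛ·wM1 j) • H μ w`; the `hM` input of
`W2SymOfK_bref_sharp`, ♯-table = table): slot twin of `SpineRecursivePureLaws.M1At_bref`. -/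
theorem M1Of_bref (hH : ∀ (α μ : Fin (d + 1)) (y : Fin (d + 1) → ℤ), H μ (bref α μ y) = reflSign α μ • refK (Φ (d := d) Lc α) (H μ y))
    (cΛ : ℝ) (j : ℕ) (α μ : Fin (d + 1)) (w : Fin (d + 1) → ℤ) :
    M1Of d Lc H cΛ j μ (bref α μ w) = reflSign α μ • refK (Φ Lc α) (M1Of d Lc H cΛ j μ w) := by
  rw [M1Of_apply, M1Of_apply, hH, refK_smul, smul_comm]

/-- [folklore] **THE UNFOLDED (PURE) TABLES INHERIT THE FOLDED FAMILY's (Sr-conj) LAW WITH THE SAME CONTACT, AT EVERY LEVEL**: if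
`SrecOf V H G … j κ (bref u) = ε • refK (SrecOf … j κ u + C j κ u)` for all `j κ u` and (H-r) holds, then the same law holds for `SpureRecOf V H G … j`
(level `0`: minus `cΛ • SLam (lamCoeffOf KInv) H`; level `j+1`: minus `(cΛ·wΛ (j+1)) • SLam (lamCoeffK (KInvStep (j+1)) (E2 (j+1))) H`, both pure-sign). -/
theorem SpureRecOf_bref_of_SrecOf_bref {cE cVH cΛ : ℝ} {α : Fin (d + 1)}
    {C : ℕ → Fin (d + 1) → (Fin (d + 1) → ℤ) → MKer (d + 1) (Fib d)}
    (hH : ∀ (α' μ : Fin (d + 1)) (y : Fin (d + 1) → ℤ), H μ (bref α' μ y) = reflSign α' μ • refK (Φ (d := d) Lc α') (H μ y))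
    (hS : ∀ (j : ℕ) (κ : Fin (d + 1)) (u : Fin (d + 1) → ℤ),
      SrecOf d Lc V H G cE cVH cΛ j κ (bref α κ u) = reflSign α κ • refK (Φ Lc α) (SrecOf d Lc V H G cE cVH cΛ j κ u + C j κ u)) :
    ∀ (j : ℕ) (κ : Fin (d + 1)) (u : Fin (d + 1) → ℤ),
      SpureRecOf d Lc V H G cE cVH cΛ j κ (bref α κ u) = reflSign α κ • refK (Φ Lc α) (SpureRecOf d Lc V H G cE cVH cΛ j κ u + C j κ u)
  | 0, κ, u => by
    have e : ∀ (κ' : Fin (d + 1)) (u' : Fin (d + 1) → ℤ), SpureRecOf d Lc V H G cE cVH cΛ 0 κ' u' =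
        SrecOf d Lc V H G cE cVH cΛ 0 κ' u' - cΛ • SLam Lc (lamCoeffOf (KInv (N := Lc) (d := d)) Lc) H κ' u' := fun κ' u' => by
      rw [SrecOf_eq_SpureRecOf_add_lam_zero, add_sub_cancel_right]
    have hP : cΛ • SLam Lc (lamCoeffOf (KInv (N := Lc) (d := d)) Lc) H κ (bref α κ u) =
        reflSign α κ • refK (Φ Lc α) (cΛ • SLam Lc (lamCoeffOf (KInv (N := Lc) (d := d)) Lc) H κ u) := by
      rw [SLam_lamCoeffOf_reflect_slot hH α κ u, refK_smul, smul_comm]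
    rw [e, e, hS 0 κ u, hP, ← smul_sub, ← refK_sub]
    congr 2
    abel
  | j + 1, κ, u => by
    have e : ∀ (κ' : Fin (d + 1)) (u' : Fin (d + 1) → ℤ), SpureRecOf d Lc V H G cE cVH cΛ (j + 1) κ' u' =
        SrecOf d Lc V H G cE cVH cΛ (j + 1) κ' u' -
          (cΛ * wΛ d Lc (j + 1)) • SLam Lc (lamCoeffK (KInvStep (d := d) Lc (j + 1)) (E2 d Lc (j + 1)) Lc) H κ' u' := fun κ' u' => by
      rw [SrecOf_eq_SpureRecOf_add_lam_succ, add_sub_cancel_right]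
    rw [e, e, hS (j + 1) κ u, smul_SLam_step_reflect_slot hH cΛ (j + 1) α κ u, ← smul_sub, ← refK_sub]
    congr 2
    abel

end Slot

/-! ## §2 The literal (`d + 1 = 4`, pins of record): (Sr-conj) for `SpureSymOf tabs` at every level -/

section Literal

/-- [folklore] **(Sr-conj) FOR THE LITERAL's UNFOLDED FIRST-ORDER TABLES `SpureSymOf tabs Lc⁴ (−Lc⁴·½·Lc⁴) cΛ` AT EVERY LEVEL, SAME CONTACT AS THE FOLDED
FAMILY** — hypotheses EXACTLY those of `ReflectionLocusSymShift.hSrC_SsymOf_all` (shift letters (Dspr)(Dnull)(Dff)(Dmm)(DG); table letters (V-r)(V-ff0)(H-r)). -/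
theorem SpureSymOf_bref_all (hLc : Odd Lc) (tabs : SymTables 3 Lc) (cΛ : ℝ) {Dsh : MKer 4 (Fib 3)} (hD : Spr Dsh)
    (hDnull : comp (comp (symEc Lc) Dsh) (symEc Lc) = 0)
    (hDff : ∀ (x z : Fin 4 → ℤ) (β β' : Fin 4), Dsh x z (Sum.inl β) (Sum.inl β') = 0)
    (hDmm : ∀ (x y : Fin 4 → ℤ) (κ l : Fin 4), Dsh x y (Sum.inr κ) (Sum.inr l) = 0)
    (hGD : ∀ (j : ℕ) (x z : Fin 4 → ℤ) (m a : Fin 4), comp (Gsym (d := 3) Lc j) Dsh x z (Sum.inr m) (Sum.inl a) = 0)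
    (hDG : ∀ (j : ℕ) (x z : Fin 4 → ℤ) (a m : Fin 4), comp Dsh (Gsym (d := 3) Lc j) x z (Sum.inl a) (Sum.inr m) = 0)
    {α : Fin 4}
    (hVfm : ∀ (κ' : Fin 4) (u x z : Fin 4 → ℤ) (β μ : Fin 4), tabs.V κ' (bref α κ' u) x z (Sum.inl β) (Sum.inr μ) =
      (reflSign α κ' • refK (Φ (d := 3) Lc α) (tabs.V κ' u + conjV (bhK (d := 3) Lc + Dsh)
        ((((Lc : ℝ) ^ 4)⁻¹) • diagK (ctGenM 3 (bhK Lc + Dsh) α Lc κ' u)))) x z (Sum.inl β) (Sum.inr μ))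
    (hVmf : ∀ (κ' : Fin 4) (u x z : Fin 4 → ℤ) (μ β : Fin 4), tabs.V κ' (bref α κ' u) x z (Sum.inr μ) (Sum.inl β) =
      (reflSign α κ' • refK (Φ (d := 3) Lc α) (tabs.V κ' u + conjV (bhK (d := 3) Lc + Dsh)
        ((((Lc : ℝ) ^ 4)⁻¹) • diagK (ctGenM 3 (bhK Lc + Dsh) α Lc κ' u)))) x z (Sum.inr μ) (Sum.inl β))
    (hVmm : ∀ (κ' : Fin 4) (u x z : Fin 4 → ℤ) (μ μ' : Fin 4), tabs.V κ' (bref α κ' u) x z (Sum.inr μ) (Sum.inr μ') =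
      (reflSign α κ' • refK (Φ (d := 3) Lc α) (tabs.V κ' u + conjV (bhK (d := 3) Lc + Dsh)
        ((((Lc : ℝ) ^ 4)⁻¹) • diagK (ctGenM 3 (bhK Lc + Dsh) α Lc κ' u)))) x z (Sum.inr μ) (Sum.inr μ'))
    (hV0 : ∀ (κ : Fin 4) (w x z : Fin 4 → ℤ) (β β' : Fin 4), tabs.V κ w x z (Sum.inl β) (Sum.inl β') = 0)
    (hHr : ∀ (α' μ : Fin 4) (y : Fin 4 → ℤ), tabs.H μ (bref α' μ y) = reflSign α' μ • refK (Φ (d := 3) Lc α') (tabs.H μ y)) :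
    ∀ (j : ℕ) (κ : Fin 4) (u : Fin 4 → ℤ),
      SpureSymOf tabs ((Lc : ℝ) ^ 4) (-((Lc : ℝ) ^ 4 * (1 / 2) * (Lc : ℝ) ^ 4)) cΛ j κ (bref α κ u) =
        reflSign α κ • refK (Φ Lc α) (SpureSymOf tabs ((Lc : ℝ) ^ 4) (-((Lc : ℝ) ^ 4 * (1 / 2) * (Lc : ℝ) ^ 4)) cΛ j κ u +
          conjV (bhKStepSh 3 Lc Dsh j) ((-((Lc : ℝ) ^ 4 * (1 / 2) * (Lc : ℝ) ^ 4) * wVH 3 Lc j / (stepScale 3 Lc j * (Lc : ℝ) ^ 4)) •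
            diagK (ctGenM 3 (bhK Lc + Dsh) α Lc κ u))) := by
  have hS := hSrC_SsymOf_all hLc tabs cΛ hD hDnull hDff hDmm hGD hDG hVfm hVmf hVmm hV0 hHr
  rw [SsymOf_eq] at hS
  exact SpureRecOf_bref_of_SrecOf_bref (d := 3) hHr hS

end Literal

/-! ## §3 At an1's typed shift `Dsh Lc`: every shift letter a theorem -/

section An1Shift

/-- [folklore] **(Sr-conj) FOR `SpureSymOf tabs` AT an1's TYPED SHIFT `DshAn1.Dsh Lc`, EVERY LEVEL** — the shift letters DISCHARGED exactly as in
`DshAn1End` §8 ((Dspr) `spr_Dsh`, (Dnull) `comp_comp_symEc_Dsh_symEc`, (Dff)(Dmm) `rfl`, (DG) by `SymShiftGaugeBlind` from (Dgrad)(Dskew)); displayed: the table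
letters (V-r) (three border leg pairs, generator `ctGenM 3 (bhK Lc + Dsh Lc)`), (V-ff0), (H-r). -/
theorem SpureSymOf_bref_all_an1Shift (hLc : Odd Lc) (tabs : SymTables 3 Lc) (cΛ : ℝ) {α : Fin 4}
    (hVfm : ∀ (κ' : Fin 4) (u x z : Fin 4 → ℤ) (β μ : Fin 4), tabs.V κ' (bref α κ' u) x z (Sum.inl β) (Sum.inr μ) =
      (reflSign α κ' • refK (Φ (d := 3) Lc α) (tabs.V κ' u + conjV (bhK (d := 3) Lc + Dsh Lc)
        ((((Lc : ℝ) ^ 4)⁻¹) • diagK (ctGenM 3 (bhK Lc + Dsh Lc) α Lc κ' u)))) x z (Sum.inl β) (Sum.inr μ))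
    (hVmf : ∀ (κ' : Fin 4) (u x z : Fin 4 → ℤ) (μ β : Fin 4), tabs.V κ' (bref α κ' u) x z (Sum.inr μ) (Sum.inl β) =
      (reflSign α κ' • refK (Φ (d := 3) Lc α) (tabs.V κ' u + conjV (bhK (d := 3) Lc + Dsh Lc)
        ((((Lc : ℝ) ^ 4)⁻¹) • diagK (ctGenM 3 (bhK Lc + Dsh Lc) α Lc κ' u)))) x z (Sum.inr μ) (Sum.inl β))
    (hVmm : ∀ (κ' : Fin 4) (u x z : Fin 4 → ℤ) (μ μ' : Fin 4), tabs.V κ' (bref α κ' u) x z (Sum.inr μ) (Sum.inr μ') =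
      (reflSign α κ' • refK (Φ (d := 3) Lc α) (tabs.V κ' u + conjV (bhK (d := 3) Lc + Dsh Lc)
        ((((Lc : ℝ) ^ 4)⁻¹) • diagK (ctGenM 3 (bhK Lc + Dsh Lc) α Lc κ' u)))) x z (Sum.inr μ) (Sum.inr μ'))
    (hV0 : ∀ (κ : Fin 4) (w x z : Fin 4 → ℤ) (β β' : Fin 4), tabs.V κ w x z (Sum.inl β) (Sum.inl β') = 0)
    (hHr : ∀ (α' μ : Fin 4) (y : Fin 4 → ℤ), tabs.H μ (bref α' μ y) = reflSign α' μ • refK (Φ (d := 3) Lc α') (tabs.H μ y)) :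
    ∀ (j : ℕ) (κ : Fin 4) (u : Fin 4 → ℤ),
      SpureSymOf tabs ((Lc : ℝ) ^ 4) (-((Lc : ℝ) ^ 4 * (1 / 2) * (Lc : ℝ) ^ 4)) cΛ j κ (bref α κ u) =
        reflSign α κ • refK (Φ Lc α) (SpureSymOf tabs ((Lc : ℝ) ^ 4) (-((Lc : ℝ) ^ 4 * (1 / 2) * (Lc : ℝ) ^ 4)) cΛ j κ u +
          conjV (bhKStepSh 3 Lc (Dsh Lc) j) ((-((Lc : ℝ) ^ 4 * (1 / 2) * (Lc : ℝ) ^ 4) * wVH 3 Lc j / (stepScale 3 Lc j * (Lc : ℝ) ^ 4)) •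
            diagK (ctGenM 3 (bhK Lc + Dsh Lc) α Lc κ u))) := by
  have hLc1 : 1 ≤ Lc := one_le_of_neZero Lc
  have hDff : ∀ (x z : Fin 4 → ℤ) (β β' : Fin 4), Dsh Lc x z (Sum.inl β) (Sum.inl β') = 0 := fun x z β β' => Dsh_inl_inl Lc x z β β'
  have hDskew : ∀ (x z : Fin 4 → ℤ) (a' m : Fin 4), Dsh Lc x z (Sum.inl a') (Sum.inr m) = -Dsh Lc z x (Sum.inr m) (Sum.inl a') := fun x z a' m => by
    rw [Dsh_inr_inl_eq_neg, neg_neg]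
  have hDgrad : ∀ (z : Fin 4 → ℤ) (b : Fin 4), ∃ pot : (Fin 4 → ℤ) → ℝ, (Function.support pot).Finite ∧
      ∀ (x : Fin 4 → ℤ) (m : Fin 4), Torus.proj Lc x = 0 → Dsh Lc x z (Sum.inr m) (Sum.inl b) = pot (quo Lc x + unitVec m) - pot (quo Lc x) := fun z b =>
    ⟨fun Y => -lam04 Lc b z Y, (Set.finite_singleton (blk Lc z)).subset (fun Y hY => by
        by_contra hne
        apply hY
        show -lam04 Lc b z Y = 0
        rw [lam04_eq_zero_of_ne_blk hLc1 (fun h => hne (Set.mem_singleton_iff.mpr h)), neg_zero]),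
      fun x m hx => by rw [Dsh_inr_inl_eq_neg, Dsh_inl_inr_eq_sub, if_pos hx]; ring⟩
  exact SpureSymOf_bref_all hLc tabs cΛ (spr_Dsh hLc1) (comp_comp_symEc_Dsh_symEc hLc1) hDff (fun x y κ l => Dsh_inr_inr Lc x y κ l)
    (fun j x z m b => comp_Gsym_Dsh_inr_inl_of_grad hDff hDgrad j x z m b) (fun j x z a' m => comp_Dsh_Gsym_inl_inr_of_grad hDff hDskew hDgrad j x z a' m)
    hVfm hVmf hVmm hV0 hHr

end An1Shift

/-! ## §4 At an1's first-order table record `symTablesAn1 3 Lc …`: (V-ff0) discharged; (V-r)(H-r) about an1's concrete tables -/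

section An1Tables

variable (cΛ : ℝ)
    (vh₂S : Fin (3 + 1) → (Fin (3 + 1) → ℤ) → Fin (3 + 1) → (Fin (3 + 1) → ℤ) → MKer (3 + 1) (Fib 3))
    (mixFF : Fin (3 + 1) → (Fin (3 + 1) → ℤ) → Fin (3 + 1) → (Fin (3 + 1) → ℤ) → MKer (3 + 1) (Fib 3))
    (hB : ∃ C δ : ℝ, 0 < δ ∧ LocStencil₂ vh₂S C δ) (hmix : ∃ C δ : ℝ, 0 < δ ∧ LocStencilFM Lc mixFF C δ)
    (hBt : ∀ (κ : Fin (3 + 1)) (u : Fin (3 + 1) → ℤ) (κ' : Fin (3 + 1)) (u' t : Fin (3 + 1) → ℤ),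
      vh₂S κ (u + (Lc : ℤ) • t) κ' (u' + (Lc : ℤ) • t) = ExpKernelCalculus.shiftK (-((Lc : ℤ) • t)) (vh₂S κ u κ' u'))
    (hmixt : ∀ (κ : Fin (3 + 1)) (u : Fin (3 + 1) → ℤ) (μ : Fin (3 + 1)) (w t : Fin (3 + 1) → ℤ),
      mixFF κ (u + (Lc : ℤ) • t) μ (w + t) = ExpKernelCalculus.shiftK (-((Lc : ℤ) • t)) (mixFF κ u μ w))

omit [NeZero Lc] in
/-- [folklore] **THE MULTIPLIER TABLES OF THE RECORD, `M1Of 3 Lc (symHessFFAt ρ_c Lc) cΛ j`, REFLECT BY A PURE SIGN** given (H-r) for an1's `symHessFFAt ρ_c`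
(the root's binder `hHr`, verbatim). -/
theorem M1Of_symHessFFAt_bref
    (hHr : ∀ (α μ : Fin 4) (y : Fin 4 → ℤ),
      symHessFFAt (ctr 4 Lc) Lc μ (bref α μ y) = reflSign α μ • refK (Φ (d := 3) Lc α) (symHessFFAt (ctr 4 Lc) Lc μ y))
    (j : ℕ) (α μ : Fin 4) (w : Fin 4 → ℤ) :
    M1Of 3 Lc (symHessFFAt (ctr 4 Lc) Lc) cΛ j μ (bref α μ w) = reflSign α μ • refK (Φ Lc α) (M1Of 3 Lc (symHessFFAt (ctr 4 Lc) Lc) cΛ j μ w) :=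
  M1Of_bref (d := 3) hHr cΛ j α μ w

/-- [folklore] **(Sr-conj) FOR THE UNFOLDED FIRST-ORDER TABLES OF THE LITERAL AT an1's TABLE RECORD AND an1's SHIFT, EVERY LEVEL** — hypotheses: the root
p273819's reflection binders `hVfm`∕`hVmf`∕`hVmm` ((V-r) for `symVhSAt (ctr 4 Lc) 3 Lc`) and `hHr` ((H-r) for `symHessFFAt (ctr 4 Lc) Lc`) VERBATIM; (V-ff0) is
an1's `symVhSAt_hV0_ctr`. -/
theorem SpureSymOf_bref_all_an1Tables (hLc : Odd Lc) {α : Fin 4}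
    (hVfm : ∀ (κ' : Fin 4) (u x z : Fin 4 → ℤ) (β m : Fin 4), symVhSAt (ctr 4 Lc) 3 Lc rfl κ' (bref α κ' u) x z (Sum.inl β) (Sum.inr m) =
      (reflSign α κ' • refK (Φ (d := 3) Lc α) (symVhSAt (ctr 4 Lc) 3 Lc rfl κ' u + conjV (bhK (d := 3) Lc + Dsh Lc)
        ((((Lc : ℝ) ^ 4)⁻¹) • diagK (ctGenM 3 (bhK Lc + Dsh Lc) α Lc κ' u)))) x z (Sum.inl β) (Sum.inr m))
    (hVmf : ∀ (κ' : Fin 4) (u x z : Fin 4 → ℤ) (m β : Fin 4), symVhSAt (ctr 4 Lc) 3 Lc rfl κ' (bref α κ' u) x z (Sum.inr m) (Sum.inl β) =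
      (reflSign α κ' • refK (Φ (d := 3) Lc α) (symVhSAt (ctr 4 Lc) 3 Lc rfl κ' u + conjV (bhK (d := 3) Lc + Dsh Lc)
        ((((Lc : ℝ) ^ 4)⁻¹) • diagK (ctGenM 3 (bhK Lc + Dsh Lc) α Lc κ' u)))) x z (Sum.inr m) (Sum.inl β))
    (hVmm : ∀ (κ' : Fin 4) (u x z : Fin 4 → ℤ) (m m' : Fin 4), symVhSAt (ctr 4 Lc) 3 Lc rfl κ' (bref α κ' u) x z (Sum.inr m) (Sum.inr m') =
      (reflSign α κ' • refK (Φ (d := 3) Lc α) (symVhSAt (ctr 4 Lc) 3 Lc rfl κ' u + conjV (bhK (d := 3) Lc + Dsh Lc)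
        ((((Lc : ℝ) ^ 4)⁻¹) • diagK (ctGenM 3 (bhK Lc + Dsh Lc) α Lc κ' u)))) x z (Sum.inr m) (Sum.inr m'))
    (hHr : ∀ (α' μ : Fin 4) (y : Fin 4 → ℤ),
      symHessFFAt (ctr 4 Lc) Lc μ (bref α' μ y) = reflSign α' μ • refK (Φ (d := 3) Lc α') (symHessFFAt (ctr 4 Lc) Lc μ y)) :
    ∀ (j : ℕ) (κ : Fin 4) (u : Fin 4 → ℤ),
      SpureSymOf (symTablesAn1 3 Lc cΛ vh₂S mixFF hB hmix hBt hmixt) ((Lc : ℝ) ^ 4) (-((Lc : ℝ) ^ 4 * (1 / 2) * (Lc : ℝ) ^ 4)) cΛ j κ (bref α κ u) =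
        reflSign α κ • refK (Φ Lc α)
          (SpureSymOf (symTablesAn1 3 Lc cΛ vh₂S mixFF hB hmix hBt hmixt) ((Lc : ℝ) ^ 4) (-((Lc : ℝ) ^ 4 * (1 / 2) * (Lc : ℝ) ^ 4)) cΛ j κ u +
            conjV (bhKStepSh 3 Lc (Dsh Lc) j) ((-((Lc : ℝ) ^ 4 * (1 / 2) * (Lc : ℝ) ^ 4) * wVH 3 Lc j / (stepScale 3 Lc j * (Lc : ℝ) ^ 4)) •
              diagK (ctGenM 3 (bhK Lc + Dsh Lc) α Lc κ u))) :=
  SpureSymOf_bref_all_an1Shift hLc (symTablesAn1 3 Lc cΛ vh₂S mixFF hB hmix hBt hmixt) cΛ hVfm hVmf hVmm (symVhSAt_hV0_ctr Lc) hHr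

end An1Tables

end Summit.QuantumFields.BalabanUV.Beta.ReflectionLocusSymPure

end
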